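import Summits.KontsevichZagierPeriods.KontsevichZagierPeriods.Theorems.AbelContractionRealHyperellipticSectorDefs
import Summits.KontsevichZagierPeriods.KontsevichZagierPeriods.Theorems.AbelContractionRealHyperellipticSectorBudgetKit
import Summits.KontsevichZagierPeriods.KontsevichZagierPeriods.Theorems.HurwitzMicroSectorsNormalFormPrincipleDimOneCells

/-!
# Route AbelContraction — `RealHyperellipticSector` (crux stmt-KontsevichZagierPeriods-12475): the cells stub

Pure proof file of the line `Lines/birth.lean` (registered stub `stub_cells`, `--supports` the
crux). **Cell normalisation inside dimension `≤ 1`**: every element of the subgroup of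
`KZ.FormalRep` generated by the sector generators `[σ, (A + B√q)/D]` of `q ∈ ℚ[X]` (`sector q`) and
the constants (`consts`) is congruent modulo the truncated relations `KZ.relationsLE 1` to an
element of the subgroup generated by the ARC generators (`arcs q`: same integrands, domain
LITERALLY a coordinate slab `{p | p 0 ∈ S}` over an open order-connected `S ⊆ ℝ`) and the constants.

Proof. The statement is `closure (sector q ∪ consts) ≤ closure (arcs q ∪ consts) ⊔ relationsLE 1`,
so it suffices to put each sector generator `[σ, f]` in the right-hand subgroup `H`. This is done
for an abstract restriction-stable property `P` of one-dimensional representations in place of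
"has the sector shape with data `A B D`" and an abstract subgroup `H ≥ relationsLE 1` containing
every `P`-representation over a slab (`Cells.of_mem_of_stable`): take the finite set `F` of real
ALGEBRAIC break points of `σ` (`PiBox.Dlog.exists_algebraic_breakpoints`: a slab avoiding `F` lies
in `σ` or misses it), cut `[σ, f]` at a rational `M > F` (rule 1a twice, `Budget.split_mem_relationsLE`;
the cut point is null, `Budget.of_mem_relationsLE_of_subset_point`; the ray beyond `M` is all in
or all out, `Cells.ray_subset_or_disjoint`), and treat the piece below `M` by induction on `F`
along its maximum (`Cells.of_mem_of_breakpoints`, the bookkeeping of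
`PiBox.Dlog.nfD_of_breakpoints` redone inside the budget): cut at the largest break point `z`, the
piece over `(z, u)` is the whole slab or nothing, the piece below `z` is the induction hypothesis,
and with no break point left a subset of `{x₀ < u}` meeting every slab `(p, u)` all-or-nothing is
`{x₀ < u}` or `∅` (`Cells.eq_Iio_or_eq_empty`).

References: L. van den Dries, *Tame topology and o-minimal structures* (1998), Ch. 1 (3.2)–(3.3)
[Dries1998]; M. Kontsevich, D. Zagier, *Periods* (2001), §1.2 rule (1) [KontsevichZagier2001].
No definitions are introduced.
-/

noncomputable section

open Set MeasureTheory
open Literature.ModelTheory.ExponentialFields (IsSemialgebraic)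
open Literature.NumberTheory.Transcendental Literature.NumberTheory.Transcendental.KZ
open Summit.KontsevichZagierPeriods.HurwitzMicroSectors.NormalFormPrinciple.PiBox.Dlog
  (exists_algebraic_breakpoints)

namespace Summit.KontsevichZagierPeriods.AbelContraction.RealHyperellipticSector

namespace Cells

/-! ## Bookkeeping -/

/-- If `a − b − c`, `b` and `c` lie in a subgroup then so does `a`. [folklore] -/
theorem mem_of_sub_sub_mem {H : AddSubgroup FormalRep} {a b c : FormalRep} (h : a - b - c ∈ H)
    (hb : b ∈ H) (hc : c ∈ H) : a ∈ H := by
  have e : a = a - b - c + b + c := by abel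
  rw [e]
  exact H.add_mem (H.add_mem h hb) hc

/-- **Cell splitting with a restriction-stable property** (rule (1a) inside dimension `≤ 1`): a
one-dimensional representation `N` with a property `P` stable under restriction splits along any
`ℚ`-semialgebraic `A` into two representations with property `P`, of domains `σ ∩ A` and `σ ∖ A`,
modulo `relationsLE 1`. [cite: KontsevichZagier2001, §1.2 rule (1)] -/
theorem exists_split {P : IntegralRep 1 → Prop}
    (hP : ∀ (N : IntegralRep 1) (s : Set (Fin 1 → ℝ)) (hs : IsSemialgebraic ℚ s)
      (hsN : s ⊆ N.domain), P N → P (N.restrict s hs hsN))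
    (N : IntegralRep 1) (hN : P N) (A : Set (Fin 1 → ℝ)) (hA : IsSemialgebraic ℚ A) :
    ∃ N₁ N₂ : IntegralRep 1, N₁.domain = N.domain ∩ A ∧ N₂.domain = N.domain \ A ∧ P N₁ ∧ P N₂ ∧
      of N - of N₁ - of N₂ ∈ relationsLE 1 :=
  ⟨N.restrict (N.domain ∩ A) (N.isSemialgebraic_domain.inter hA) inter_subset_left,
    N.restrict (N.domain \ A) (N.isSemialgebraic_domain.diff hA) sdiff_subset, rfl, rfl,
    hP N _ _ _ hN, hP N _ _ _ hN, Budget.split_mem_relationsLE le_rfl N A hA⟩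

/-! ## Two pieces of interval combinatorics on the line -/

/-- **A ray avoiding the break points is all in or all out**: if every slab `{M < x₀ < q'}` lies in
`σ` or misses `σ`, then the ray `{M < x₀}` lies in `σ` or misses `σ`. [cite: Dries1998, Ch. 1 (3.3)] -/
theorem ray_subset_or_disjoint {σ : Set (Fin 1 → ℝ)} {M : ℝ}
    (h : ∀ q' : ℝ, {x : Fin 1 → ℝ | x 0 ∈ Ioo M q'} ⊆ σ ∨
      Disjoint {x : Fin 1 → ℝ | x 0 ∈ Ioo M q'} σ) :
    {x : Fin 1 → ℝ | M < x 0} ⊆ σ ∨ Disjoint {x : Fin 1 → ℝ | M < x 0} σ := by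
  by_cases hex : ∃ x₀ ∈ σ, M < x₀ 0
  · obtain ⟨x₀, hx₀σ, hx₀⟩ := hex
    refine Or.inl fun y hy => ?_
    have hy' : M < y 0 := hy
    rcases h (max (x₀ 0) (y 0) + 1) with h' | h'
    · exact h' ⟨hy', by linarith [le_max_right (x₀ 0) (y 0)]⟩
    · exact absurd hx₀σ (Set.disjoint_left.1 h' ⟨hx₀, by linarith [le_max_left (x₀ 0) (y 0)]⟩)
  · exact Or.inr (Set.disjoint_left.2 fun x hx hxσ => hex ⟨x, hxσ, hx⟩)

/-- **No break point below `u`**: a subset of `{x₀ < u}` meeting every slab `{p < x₀ < u}`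
all-or-nothing is the whole half-line `{x₀ < u}` or empty. [cite: Dries1998, Ch. 1 (3.3)] -/
theorem eq_Iio_or_eq_empty {σ : Set (Fin 1 → ℝ)} {u : ℝ} (hsub : σ ⊆ {x | x 0 < u})
    (h : ∀ p : ℝ, {x : Fin 1 → ℝ | x 0 ∈ Ioo p u} ⊆ σ ∨
      Disjoint {x : Fin 1 → ℝ | x 0 ∈ Ioo p u} σ) :
    σ = {x | x 0 ∈ Iio u} ∨ σ = {x | x 0 ∈ (∅ : Set ℝ)} := by
  rcases Set.eq_empty_or_nonempty σ with hσ | ⟨x₀, hx₀⟩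
  · refine Or.inr ?_
    rw [hσ]
    exact (eq_empty_of_forall_notMem fun x hx => hx).symm
  · refine Or.inl (Set.Subset.antisymm hsub fun y hy => ?_)
    have hy' : y 0 < u := hy
    have hx₀' : x₀ 0 < u := hsub hx₀
    rcases h (min (x₀ 0) (y 0) - 1) with h' | h'
    · exact h' ⟨by linarith [min_le_right (x₀ 0) (y 0)], hy'⟩
    · exact absurd hx₀ (Set.disjoint_left.1 h' ⟨by linarith [min_le_left (x₀ 0) (y 0)], hx₀'⟩)

/-! ## Induction on the break points inside the budget -/

/-- **Decomposition at algebraic break points inside dimension `≤ 1`.** Let `P` be a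
restriction-stable property of one-dimensional representations and `H ≥ relationsLE 1` a subgroup
containing `[N]` for every `P`-representation `N` whose domain is a slab `{p | p 0 ∈ S}`, `S` open
and order-connected. Let `N` be a `P`-representation with domain in `{x₀ < u}` and `F` a finite set
of real algebraic points below `u` such that every slab below `u` avoiding `F` lies in `N.domain` or
misses it. Then `[N] ∈ H`: cut at the largest break point `z` (two rule-(1a) instances, the cut
point being null), the right piece is the slab over `(z, u)` or empty, and recurse on the left piece
below `z`. [cite: KontsevichZagier2001, §1.2 rule (1)] [cite: Dries1998, Ch. 1 (3.2)-(3.3)] -/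
theorem of_mem_of_breakpoints {P : IntegralRep 1 → Prop} {H : AddSubgroup FormalRep}
    (hH : relationsLE 1 ≤ H)
    (hP : ∀ (N : IntegralRep 1) (s : Set (Fin 1 → ℝ)) (hs : IsSemialgebraic ℚ s)
      (hsN : s ⊆ N.domain), P N → P (N.restrict s hs hsN))
    (hG : ∀ (N : IntegralRep 1) (S : Set ℝ), P N → IsOpen S → S.OrdConnected →
      N.domain = {x | x 0 ∈ S} → of N ∈ H)
    (F : Finset ℝ) :
    ∀ (u : ℝ) (N : IntegralRep 1), (∀ z ∈ F, IsAlgebraic ℚ z) → (∀ z ∈ F, z < u) →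
      N.domain ⊆ {x | x 0 < u} →
      (∀ p q' : ℝ, q' ≤ u → (∀ z ∈ F, z ∉ Ioo p q') →
        {x : Fin 1 → ℝ | x 0 ∈ Ioo p q'} ⊆ N.domain ∨
          Disjoint {x : Fin 1 → ℝ | x 0 ∈ Ioo p q'} N.domain) →
      P N → of N ∈ H := by
  classical
  induction F using Finset.induction_on_max with
  | empty =>
    intro u N _ _ hsub hdich hN
    rcases eq_Iio_or_eq_empty hsub
        (fun p => hdich p u le_rfl fun z hz => (Finset.notMem_empty z hz).elim) with h | h
    · exact hG N (Iio u) hN isOpen_Iio ordConnected_Iio h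
    · exact hG N ∅ hN isOpen_empty ordConnected_empty h
  | insert z F hzmax ih =>
    intro u N halg hlt hsub hdich hN
    have hzA : IsAlgebraic ℚ z := halg z (Finset.mem_insert_self z F)
    have hzu : z < u := hlt z (Finset.mem_insert_self z F)
    obtain ⟨Nl, N', hNl, hN', hPl, hP', h1⟩ :=
      exists_split hP N hN {x | x 0 < z} (isSemialgebraic_setOf_apply_lt_const hzA 0)
    obtain ⟨Nr, Np, hNr, hNp, hPr, -, h2⟩ :=
      exists_split hP N' hP' {x | z < x 0} (isSemialgebraic_setOf_const_lt_apply hzA 0)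
    refine mem_of_sub_sub_mem (hH h1) ?_ (mem_of_sub_sub_mem (hH h2) ?_ ?_)
    · -- the left piece: induction hypothesis with bound `z`
      refine ih z Nl (fun w hw => halg w (Finset.mem_insert_of_mem hw)) hzmax ?_ ?_ hPl
      · rw [hNl]
        exact fun x hx => hx.2
      · intro p q' hq' havoid
        have havoid' : ∀ w ∈ insert z F, w ∉ Ioo p q' := by
          intro w hw
          rcases Finset.mem_insert.mp hw with rfl | hw
          · exact fun h => not_lt.mpr hq' h.2
          · exact havoid w hw
        rw [hNl]
        rcases hdich p q' (hq'.trans hzu.le) havoid' with h | h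
        · exact Or.inl fun x hx => ⟨h hx, lt_of_lt_of_le hx.2 hq'⟩
        · exact Or.inr (h.mono_right inter_subset_left)
    · -- the right piece: the slab over `(z, u)`, or nothing
      have havoid : ∀ w ∈ insert z F, w ∉ Ioo z u := by
        intro w hw
        rcases Finset.mem_insert.mp hw with rfl | hw
        · exact fun h => lt_irrefl _ h.1
        · exact fun h => lt_asymm (hzmax w hw) h.1
      rw [hN'] at hNr
      rcases hdich z u le_rfl havoid with h | h
      · refine hG Nr (Ioo z u) hPr isOpen_Ioo ordConnected_Ioo ?_
        rw [hNr]
        ext x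
        constructor
        · rintro ⟨⟨hx, -⟩, hzx⟩
          exact ⟨hzx, hsub hx⟩
        · rintro ⟨hzx, hxu⟩
          exact ⟨⟨h ⟨hzx, hxu⟩, fun hxz => lt_asymm hxz hzx⟩, hzx⟩
      · refine hG Nr ∅ hPr isOpen_empty ordConnected_empty ?_
        rw [hNr, show ({x : Fin 1 → ℝ | x 0 ∈ (∅ : Set ℝ)}) = ∅ from
          eq_empty_of_forall_notMem fun x hx => hx]
        exact eq_empty_of_forall_notMem fun x hx =>
          Set.disjoint_left.1 h ⟨hx.2, hsub hx.1.1⟩ hx.1.1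
    · -- the cut point is null
      refine hH (Budget.of_mem_relationsLE_of_subset_point le_rfl Np z ?_)
      rw [hNp, hN']
      intro x hx
      exact le_antisymm (not_lt.mp hx.2) (not_lt.mp hx.1.2)

/-- **Cell normalisation of one representation inside dimension `≤ 1`.** With `P` and `H` as in
`of_mem_of_breakpoints`, `[N] ∈ H` for EVERY `P`-representation `N` (any `ℚ`-semialgebraic domain
`σ ⊆ ℝ¹`): take the algebraic break points `F` of `σ` (`exists_algebraic_breakpoints`), cut at a
rational `M > F` (the cut point is null, the ray beyond `M` is all in or all out), and decompose the
piece below `M` at the break points. [cite: Dries1998, Ch. 1 (3.2)-(3.3)]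
[cite: KontsevichZagier2001, §1.2 rule (1)] -/
theorem of_mem_of_stable {P : IntegralRep 1 → Prop} {H : AddSubgroup FormalRep}
    (hH : relationsLE 1 ≤ H)
    (hP : ∀ (N : IntegralRep 1) (s : Set (Fin 1 → ℝ)) (hs : IsSemialgebraic ℚ s)
      (hsN : s ⊆ N.domain), P N → P (N.restrict s hs hsN))
    (hG : ∀ (N : IntegralRep 1) (S : Set ℝ), P N → IsOpen S → S.OrdConnected →
      N.domain = {x | x 0 ∈ S} → of N ∈ H)
    (N : IntegralRep 1) (hN : P N) : of N ∈ H := by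
  classical
  obtain ⟨F, hFA, hF⟩ := exists_algebraic_breakpoints N.isSemialgebraic_domain
  -- a rational bound beyond all break points
  obtain ⟨b, hb⟩ := F.bddAbove
  set M : ℝ := (⌈b⌉₊ : ℝ) + 1 with hM
  have hMA : IsAlgebraic ℚ M := (isAlgebraic_nat _).add isAlgebraic_one
  have hFM : ∀ z ∈ F, z < M := fun z hz => by
    have h1 : z ≤ b := hb (Finset.mem_coe.2 hz)
    have h2 : b ≤ ⌈b⌉₊ := Nat.le_ceil b
    rw [hM]
    linarith
  obtain ⟨N₁, N', hN₁, hN', hP₁, hP', h1⟩ :=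
    exists_split hP N hN {x | x 0 < M} (isSemialgebraic_setOf_apply_lt_const hMA 0)
  obtain ⟨N₂, N₃, hN₂, hN₃, hP₂, -, h2⟩ :=
    exists_split hP N' hP' {x | M < x 0} (isSemialgebraic_setOf_const_lt_apply hMA 0)
  refine mem_of_sub_sub_mem (hH h1) ?_ (mem_of_sub_sub_mem (hH h2) ?_ ?_)
  · -- the piece below `M`: induction on the break points
    refine of_mem_of_breakpoints hH hP hG F M N₁ hFA hFM ?_ ?_ hP₁
    · rw [hN₁]
      exact fun x hx => hx.2
    · intro p q' hq' havoid
      rw [hN₁]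
      rcases hF p q' havoid with h | h
      · exact Or.inl fun x hx => ⟨h hx, lt_of_lt_of_le hx.2 hq'⟩
      · exact Or.inr (h.mono_right inter_subset_left)
  · -- the ray beyond `M`: all in or all out
    rw [hN'] at hN₂
    rcases ray_subset_or_disjoint (σ := N.domain) (M := M)
        (fun q' => hF M q' fun z hz h => lt_asymm (hFM z hz) h.1) with h | h
    · refine hG N₂ (Ioi M) hP₂ isOpen_Ioi ordConnected_Ioi ?_
      rw [hN₂]
      ext x
      constructor
      · rintro ⟨-, hMx⟩
        exact hMx
      · intro hMx
        have hMx' : M < x 0 := hMx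
        exact ⟨⟨h hMx', fun hxM => lt_asymm hxM hMx'⟩, hMx'⟩
    · refine hG N₂ ∅ hP₂ isOpen_empty ordConnected_empty ?_
      rw [hN₂, show ({x : Fin 1 → ℝ | x 0 ∈ (∅ : Set ℝ)}) = ∅ from
        eq_empty_of_forall_notMem fun x hx => hx]
      exact eq_empty_of_forall_notMem fun x hx => Set.disjoint_left.1 h hx.2 hx.1.1
  · -- the cut point is null
    refine hH (Budget.of_mem_relationsLE_of_subset_point le_rfl N₃ M ?_)
    rw [hN₃, hN']
    intro x hx
    exact le_antisymm (not_lt.mp hx.2) (not_lt.mp hx.1.2)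

end Cells

/-- **Stub `stub_cells` (cell normalisation inside dimension `≤ 1`)** of the line `Lines/birth.lean`
of crux stmt-KontsevichZagierPeriods-12475: every element of the subgroup generated by the sector
generators of `q` and the constants is congruent modulo `KZ.relationsLE 1` to an element of the
subgroup generated by the ARC generators of `q` (same integrands `(A + B√q)/D`, domain an open
interval, ray, line or nothing) and the constants. The sector shape with data `A B D` is stable under
restriction and an arc-shaped sector generator is an arc generator, so `Cells.of_mem_of_stable` puts
every sector generator in `closure (arcs q ∪ consts) ⊔ relationsLE 1`; constants are already there.
[cite: Dries1998, Ch. 1 (3.2)-(3.3)] [cite: KontsevichZagier2001, §1.2 rule (1)] -/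
theorem stub_cells : ∀ (q : Polynomial ℚ), ∀ x ∈ AddSubgroup.closure (sector q ∪ consts),
    ∃ x' ∈ AddSubgroup.closure (arcs q ∪ consts), x - x' ∈ KZ.relationsLE 1 := by
  intro q x hx
  have hle : AddSubgroup.closure (sector q ∪ consts) ≤
      AddSubgroup.closure (arcs q ∪ consts) ⊔ KZ.relationsLE 1 := by
    rw [AddSubgroup.closure_le]
    rintro y (hy | hy)
    · obtain ⟨r, A, B, D, hpos, hint, rfl⟩ := hy
      refine Cells.of_mem_of_stable (P := fun N : KZ.IntegralRep 1 =>
          (∀ p ∈ N.domain, 0 < Polynomial.aeval (p 0) q ∧ Polynomial.aeval (p 0) D ≠ 0) ∧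
          Set.EqOn N.integrand (fun p => (Polynomial.aeval (p 0) A + Polynomial.aeval (p 0) B *
            Real.sqrt (Polynomial.aeval (p 0) q)) / Polynomial.aeval (p 0) D) N.domain)
        le_sup_right ?_ ?_ r ⟨hpos, hint⟩
      · rintro N s hs hsN ⟨hNpos, hNint⟩
        exact ⟨fun p hp => hNpos p (hsN hp), hNint.mono hsN⟩
      · rintro N S ⟨hNpos, hNint⟩ hS hOC hdom
        exact AddSubgroup.mem_sup_left
          (AddSubgroup.subset_closure (Or.inl ⟨N, A, B, D, S, hS, hOC, hdom, hNpos, hNint, rfl⟩))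
    · exact AddSubgroup.mem_sup_left (AddSubgroup.subset_closure (Or.inr hy))
  obtain ⟨g, hg, w, hw, hgw⟩ := AddSubgroup.mem_sup.mp (hle hx)
  refine ⟨g, hg, ?_⟩
  rwa [← hgw, add_sub_cancel_left]

end Summit.KontsevichZagierPeriods.AbelContraction.RealHyperellipticSector

end
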